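import Literature.AlgebraicGeometry.Frobenioids.KummerInflationRange
import Literature.NumberTheory.GaloisRepresentations.ContinuousH2
import HarnessLib

/-!
# Frobenioids II, Definition 2.2 (ii)(c): the range of the degree-two inflation map

Mochizuki, *The geometry of Frobenioids II*, Kyushu J. Math. **62** (2008) 401–460, §2, Definition
2.2 (ii) p. 17 [cite: MochizukiFrdII2008, Def 2.2 (ii) p.17]: condition (c) asks, in degree two,
that "the natural surjective homomorphism `H ↠ H_A` induces … a surjection on second cohomology
modules `H²(H_A, μ_N(A)) ↠ H²(H, μ_N(A))`", and Remark 2.2.1 (p. 18) asserts that this can always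
be achieved by a pull-back ("it follows immediately from the definitions, together with the
finiteness of the cohomology modules `H¹(H, μ_N(A))`, `H²(H, μ_N(A))` … that … there exists a
pull-back morphism `A″ → A′` in `C` such that `A″` is `(N, H)`-saturated").

Proof-only companion of `KummerReciprocity.lean` / `PadicKummerSetting.lean` (abc-iut-L1-t7),
the degree-two twin of `KummerInflationRange.lean` (degree one): along a SURJECTION `q : H ↠ H_A`
onto a discrete group, for any topological `H_A`-module `X` on which `H` acts through `q`,
* `Kummer.twoCocycle_apply_eq_of_q_eq` — a continuous inhomogeneous `2`-cocycle `c` of `H`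
  (the tree's `contTwoCocycles`, `ContinuousH2.lean`) which is constant on `Ker q`-cosets in each
  variable only depends on `(q σ, q τ)`;
* `Kummer.twoCocycleClass_mem_range_infl_two` — **descent of `2`-cocycles along `H ↠ H_A`**: such
  a `c` is, on the nose, the inflation of a continuous `2`-cocycle of `H_A` (`H_A` is discrete, so
  the descended cocycle `(q σ, q τ) ↦ c(σ, τ)` is continuous), hence its class lies in the image
  of `H²(H_A, X) → H²(H, X)`;
* `Kummer.infl_two_surjective_of_forall_exists` — the `H²`-clause of condition (c) holds as soon
  as EVERY class of `H²(H, X)` has a representative constant on `Ker(H ↠ H_A)`-cosets (for a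
  profinite `H` and finite `X` every class is so adapted to SOME open normal subgroup — the
  tree's `exists_openNormalSubgroup_adapted` — which is how Remark 2.2.1 produces saturated
  pull-backs: shrink `Ker(H ↠ H_A)` by enlarging `A`);
* `PadicKummer.Def22Context.infl_two_surjective_of_forall_exists` — the same for the map of
  Definition 2.2 (ii)(c) of any context `X` (with `H` locally compact, e.g. open in a profinite
  `G`).
Universe note: `X : TopRep.{0}` and `H : Type` (the cocycle description of `H²` lives in the
universe of the group). No definitions; nothing here concerns [IUTchIII].
-/

namespace Literature.AlgebraicGeometry.Frobenioids

open CategoryTheory Literature.NumberTheory.GaloisRepresentations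

namespace Kummer

section Two

variable {Γ : Type} [Group Γ] {tΓ : TopologicalSpace Γ} {dΓ : DiscreteTopology Γ} (HA : Subgroup Γ)
  {H : Type} [Group H] [TopologicalSpace H] [IsTopologicalGroup H] (q : H →ₜ* HA)

omit [IsTopologicalGroup H] in
/-- A continuous `2`-cocycle of `H` (acting through `q : H → H_A`) that is constant on
`Ker q`-cosets in each variable takes the same value at `(σ, τ)` and `(σ', τ')` whenever
`q σ = q σ'` and `q τ = q τ'`. [cite: MochizukiFrdII2008, Def 2.2 (ii) p.17] -/
theorem twoCocycle_apply_eq_of_q_eq (X : TopRep.{0} ℤ HA)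
    (c : contTwoCocycles (TopRep.res (q : H →* HA) X))
    (hc₁ : ∀ σ τ k : H, q k = 1 → c.1 (σ * k, τ) = c.1 (σ, τ))
    (hc₂ : ∀ σ τ k : H, q k = 1 → c.1 (σ, τ * k) = c.1 (σ, τ))
    {σ σ' τ τ' : H} (hσ : q σ = q σ') (hτ : q τ = q τ') : c.1 (σ, τ) = c.1 (σ', τ') := by
  have hkσ : q (σ⁻¹ * σ') = 1 := by rw [map_mul, map_inv, hσ, inv_mul_cancel]
  have hkτ : q (τ⁻¹ * τ') = 1 := by rw [map_mul, map_inv, hτ, inv_mul_cancel]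
  have h1 := hc₁ σ τ (σ⁻¹ * σ') hkσ
  have h2 := hc₂ σ' τ (τ⁻¹ * τ') hkτ
  rw [mul_inv_cancel_left] at h1 h2
  rw [← h1, ← h2]

variable [LocallyCompactSpace H]

/-- **Descent of `2`-cocycles along `H ↠ H_A`**: for surjective `q`, a continuous inhomogeneous
`2`-cocycle `c` of `H` with values in the `H_A`-module `X` which is constant on `Ker q`-cosets in
each variable has its class in the image of the inflation `H²(H_A, X) → H²(H, X)` — indeed `c` IS
the inflation of the descended cocycle `(q σ, q τ) ↦ c(σ, τ)` of the discrete group `H_A`.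
(Degree-two twin of `Kummer.mem_range_infl_one_iff`.) [cite: MochizukiFrdII2008, Def 2.2 (ii) p.17] -/
theorem twoCocycleClass_mem_range_infl_two (hq : Function.Surjective q) (X : TopRep.{0} ℤ HA)
    (c : contTwoCocycles (TopRep.res (q : H →* HA) X))
    (hc₁ : ∀ σ τ k : H, q k = 1 → c.1 (σ * k, τ) = c.1 (σ, τ))
    (hc₂ : ∀ σ τ k : H, q k = 1 → c.1 (σ, τ * k) = c.1 (σ, τ)) :
    twoCocycleClass _ c ∈ Set.range (infl HA q X 2).hom := by
  -- a set-theoretic section of `q`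
  let s : HA → H := Function.surjInv hq
  have hs : ∀ τ, q (s τ) = τ := Function.surjInv_eq hq
  have key : ∀ {σ σ' τ τ' : H}, q σ = q σ' → q τ = q τ' → c.1 (σ, τ) = c.1 (σ', τ') :=
    fun hσ hτ => twoCocycle_apply_eq_of_q_eq HA q X c hc₁ hc₂ hσ hτ
  -- the descended cocycle `ψ (τ₁, τ₂) := c (s τ₁, s τ₂)`
  let ψ : contTwoCocycles X :=
    ⟨⟨fun p => c.1 (s p.1, s p.2), continuous_of_discreteTopology⟩, fun τ₁ τ₂ τ₃ => by
      change X.ρ τ₁ (c.1 (s τ₂, s τ₃)) + c.1 (s τ₁, s (τ₂ * τ₃)) =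
        c.1 (s (τ₁ * τ₂), s τ₃) + c.1 (s τ₁, s τ₂)
      have h := c.2 (s τ₁) (s τ₂) (s τ₃)
      change X.ρ (q (s τ₁)) (c.1 (s τ₂, s τ₃)) + c.1 (s τ₁, s τ₂ * s τ₃) =
        c.1 (s τ₁ * s τ₂, s τ₃) + c.1 (s τ₁, s τ₂) at h
      rw [hs, key (σ := s τ₁) rfl (show q (s τ₂ * s τ₃) = q (s (τ₂ * τ₃)) by
            rw [map_mul, hs, hs, hs]),
        key (τ := s τ₃) (show q (s τ₁ * s τ₂) = q (s (τ₁ * τ₂)) by rw [map_mul, hs, hs, hs])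
          rfl] at h
      exact h⟩
  refine ⟨twoCocycleClass X ψ, ?_⟩
  have hmap : (infl HA q X 2).hom (twoCocycleClass X ψ) =
      twoCocycleClass _ (contTwoCocycles.pullback q (𝟙 (TopRep.res (q : H →* HA) X)) ψ) :=
    map_twoCocycleClass X q (𝟙 _) ψ
  rw [hmap]
  congr 1
  apply Subtype.ext
  ext ⟨σ, τ⟩
  rw [contTwoCocycles.pullback_apply, TopRep.id_apply]
  exact key (hs (q σ)) (hs (q τ))

/-- **Definition 2.2 (ii)(c), degree two, criterion**: `H²(H_A, X) → H²(H, X)` is surjective as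
soon as every class of `H²(H, X)` has a representative `2`-cocycle which is constant on
`Ker(H ↠ H_A)`-cosets in each variable. [cite: MochizukiFrdII2008, Def 2.2 (ii) p.17] -/
theorem infl_two_surjective_of_forall_exists (hq : Function.Surjective q) (X : TopRep.{0} ℤ HA)
    (h : ∀ y : continuousCohomology 2 (TopRep.res (q : H →* HA) X),
      ∃ c : contTwoCocycles (TopRep.res (q : H →* HA) X), twoCocycleClass _ c = y ∧
        (∀ σ τ k : H, q k = 1 → c.1 (σ * k, τ) = c.1 (σ, τ)) ∧
        (∀ σ τ k : H, q k = 1 → c.1 (σ, τ * k) = c.1 (σ, τ))) :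
    Function.Surjective (infl HA q X 2).hom := by
  intro y
  obtain ⟨c, rfl, hc₁, hc₂⟩ := h y
  exact twoCocycleClass_mem_range_infl_two HA q hq X c hc₁ hc₂

end Two

end Kummer

namespace PadicKummer

namespace Def22Context

variable (X : Def22Context) (N : ℕ)

/-- For a Definition 2.2 context `X` with `H` locally compact (e.g. `H` open in a profinite `G`):
the `H²`-clause of condition (c), "`H²(H_A, μ_N(A)) ↠ H²(H, μ_N(A))`", holds as soon as every
class of `H²(H, μ_N(A))` has a representative `2`-cocycle constant on `Ker(H ↠ H_A)`-cosets in
each variable (`H ↠ H_A` is surjective, `toHA_surjective`).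
[cite: MochizukiFrdII2008, Def 2.2 (ii) p.17] -/
theorem infl_two_surjective_of_forall_exists [LocallyCompactSpace X.H]
    (h : ∀ y : continuousCohomology 2
        (TopRep.res (X.qHA : X.H →* X.HA) (Kummer.muTopRep N X.O X.HA)),
      ∃ c : contTwoCocycles (TopRep.res (X.qHA : X.H →* X.HA) (Kummer.muTopRep N X.O X.HA)),
        twoCocycleClass _ c = y ∧
        (∀ σ τ k : X.H, X.qHA k = 1 → c.1 (σ * k, τ) = c.1 (σ, τ)) ∧
        (∀ σ τ k : X.H, X.qHA k = 1 → c.1 (σ, τ * k) = c.1 (σ, τ))) :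
    Function.Surjective (Kummer.infl X.HA X.qHA (Kummer.muTopRep N X.O X.HA) 2).hom :=
  Kummer.infl_two_surjective_of_forall_exists X.HA X.qHA X.toHA_surjective _ h

end Def22Context

end PadicKummer

end Literature.AlgebraicGeometry.Frobenioids
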